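import Mathlib
import Summits.Ventures.PercRepro2.SwOutShadowMultiRootDefs

/-!
# The decorated multi-root core cube: the avoidance lemmas (blind cell PercRepro2, night-4 g35,
2026-08-29; proofs/NIGHT4-G35.md §3)

The four avoidance lemmas of g34's `MultiBaseE` hold verbatim for the decorated cube, with the
decorations counted among the vertices OUTSIDE the hull `H`: at a cube point a red path from a root
visits roots and `true` arms only (it never enters a decoration — the edges from an arm to its
decoration are blue while the unit is `true`, and the arm itself is blue-attached while the unit is
`false`), a blue path from a root roots and `false` arms only, a red path from outside `H` visits
outside vertices (decorations and `l` included) and `false` arms only, a blue one outside vertices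
and `true` arms only — never a root.  Hence the hull of every root stays inside `H` and a root is in
no cluster of `l` at any cube point.
-/

namespace Summit.Ventures.PercRepro2

namespace LocRows

open Hull

variable {V : Type*} {E : Type*}

open scoped Classical

variable {ends : E → Sym2 V}

section Avoid

variable {ι : Type*} {A Z : ι → Set V} {ζ : Config E} {R H : Set V} {l : V} {RR : Finset E}
  (hb : DecoBaseE ends ζ R H l A Z RR)
include hb

/-- **Red paths from a root visit roots and `true` arms only.** -/
lemma DecoBaseE.red_closed (ω : Config (ι ⊕ ↥RR)) {x y : V}
    (hx : x ∈ R ∪ armsTrueC A (armPart ω))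
    (hxy : (openGraph ends (decoRealRR ends A Z RR ζ ω)).Adj x y) :
    y ∈ R ∪ armsTrueC A (armPart ω) := by
  obtain ⟨_, e, he, hxy⟩ := exists_edge_of_adj hxy
  rcases hx with hx | ⟨i, hi, hx⟩
  · rcases hb.base.root_edges e x y hx hxy with hy | ⟨j, hy⟩
    · exact Or.inl hy
    · have := (hb.decoRealRR_root_edge hx hxy hy).1 he
      exact Or.inr ⟨j, this, hy⟩
  · by_cases hyR : y ∈ R
    · exact Or.inl hyR
    by_cases hyH : y ∈ H
    · obtain ⟨j, hy⟩ := hb.base.arm_cover y hyH hyR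
      have hij := hb.base.arm_eq_of_edge hxy hx hy
      subst hij
      exact Or.inr ⟨i, hi, hy⟩
    · exfalso
      have := (hb.decoRealRR_out_edge hxy hx hyH).1 he
      simp [armPart] at hi
      rw [hi] at this; exact absurd this (by decide)

/-- **Blue paths from a root visit roots and `false` arms only.** -/
lemma DecoBaseE.blue_closed (ω : Config (ι ⊕ ↥RR)) {x y : V}
    (hx : x ∈ R ∪ armsFalseC A (armPart ω))
    (hxy : (openGraph ends (blue (decoRealRR ends A Z RR ζ ω))).Adj x y) :
    y ∈ R ∪ armsFalseC A (armPart ω) := by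
  obtain ⟨_, e, he, hxy⟩ := exists_edge_of_adj hxy
  rw [blue_eq_true_iff] at he
  rcases hx with hx | ⟨i, hi, hx⟩
  · rcases hb.base.root_edges e x y hx hxy with hy | ⟨j, hy⟩
    · exact Or.inl hy
    · have := hb.decoRealRR_root_edge (ω := ω) hx hxy hy
      refine Or.inr ⟨j, ?_, hy⟩
      by_contra hj
      rw [Bool.not_eq_false] at hj
      rw [this.2 hj] at he; simp at he
  · by_cases hyR : y ∈ R
    · exact Or.inl hyR
    by_cases hyH : y ∈ H
    · obtain ⟨j, hy⟩ := hb.base.arm_cover y hyH hyR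
      have hij := hb.base.arm_eq_of_edge hxy hx hy
      subst hij
      exact Or.inr ⟨i, hi, hy⟩
    · exfalso
      have := hb.decoRealRR_out_edge (ω := ω) hxy hx hyH
      simp only [armPart] at hi
      rw [this.2 hi] at he; simp at he

/-- **Red paths from the outside visit outside vertices and `false` arms only** (never a root). -/
lemma DecoBaseE.red_closed_out (ω : Config (ι ⊕ ↥RR)) {x y : V}
    (hx : x ∈ Hᶜ ∪ armsFalseC A (armPart ω))
    (hxy : (openGraph ends (decoRealRR ends A Z RR ζ ω)).Adj x y) :
    y ∈ Hᶜ ∪ armsFalseC A (armPart ω) := by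
  obtain ⟨_, e, he, hxy⟩ := exists_edge_of_adj hxy
  rcases hx with hx | ⟨i, hi, hx⟩
  · by_cases hyH : y ∈ H
    · by_cases hyR : y ∈ R
      · exact absurd (hb.mem_H_of_adj_root hyR (ends_swap hxy)) hx
      · obtain ⟨j, hy⟩ := hb.base.arm_cover y hyH hyR
        have := (hb.decoRealRR_out_edge (ends_swap hxy) hy hx).1 he
        exact Or.inr ⟨j, this, hy⟩
    · exact Or.inl hyH
  · by_cases hyH : y ∈ H
    · by_cases hyR : y ∈ R
      · exfalso
        have := (hb.decoRealRR_root_edge hyR (ends_swap hxy) hx).1 he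
        simp only [armPart] at hi
        rw [hi] at this; exact absurd this (by decide)
      · obtain ⟨j, hy⟩ := hb.base.arm_cover y hyH hyR
        have hij := hb.base.arm_eq_of_edge hxy hx hy
        subst hij
        exact Or.inr ⟨i, hi, hy⟩
    · exact Or.inl hyH

/-- **Blue paths from the outside visit outside vertices and `true` arms only** (never a root). -/
lemma DecoBaseE.blue_closed_out (ω : Config (ι ⊕ ↥RR)) {x y : V}
    (hx : x ∈ Hᶜ ∪ armsTrueC A (armPart ω))
    (hxy : (openGraph ends (blue (decoRealRR ends A Z RR ζ ω))).Adj x y) :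
    y ∈ Hᶜ ∪ armsTrueC A (armPart ω) := by
  obtain ⟨_, e, he, hxy⟩ := exists_edge_of_adj hxy
  rw [blue_eq_true_iff] at he
  rcases hx with hx | ⟨i, hi, hx⟩
  · by_cases hyH : y ∈ H
    · by_cases hyR : y ∈ R
      · exact absurd (hb.mem_H_of_adj_root hyR (ends_swap hxy)) hx
      · obtain ⟨j, hy⟩ := hb.base.arm_cover y hyH hyR
        have := hb.decoRealRR_out_edge (ω := ω) (ends_swap hxy) hy hx
        refine Or.inr ⟨j, ?_, hy⟩
        by_contra hj
        rw [Bool.not_eq_true] at hj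
        rw [this.2 hj] at he; simp at he
    · exact Or.inl hyH
  · by_cases hyH : y ∈ H
    · by_cases hyR : y ∈ R
      · exfalso
        have := hb.decoRealRR_root_edge (ω := ω) hyR (ends_swap hxy) hx
        simp only [armPart] at hi
        rw [this.2 hi] at he; simp at he
      · obtain ⟨j, hy⟩ := hb.base.arm_cover y hyH hyR
        have hij := hb.base.arm_eq_of_edge hxy hx hy
        subst hij
        exact Or.inr ⟨i, hi, hy⟩
    · exact Or.inl hyH

/-- A vertex of the red cluster of a root at a cube point is a root or lies in a `true` arm. -/
theorem DecoBaseE.mem_root_or_true_of_mem_cluster (ω : Config (ι ⊕ ↥RR)) {r x : V} (hr : r ∈ R)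
    (hx : x ∈ cluster ends (decoRealRR ends A Z RR ζ ω) r) :
    x ∈ R ∨ ∃ i, armPart ω i = true ∧ x ∈ A i :=
  mem_of_conn_of_closed (S := R ∪ armsTrueC A (armPart ω))
    (fun _ hx' _ hxy => hb.red_closed ω hx' hxy) (Or.inl hr) hx

/-- A vertex of the blue cluster of a root at a cube point is a root or lies in a `false` arm. -/
theorem DecoBaseE.mem_root_or_false_of_mem_cluster_blue (ω : Config (ι ⊕ ↥RR)) {r x : V}
    (hr : r ∈ R) (hx : x ∈ cluster ends (blue (decoRealRR ends A Z RR ζ ω)) r) :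
    x ∈ R ∨ ∃ i, armPart ω i = false ∧ x ∈ A i :=
  mem_of_conn_of_closed (S := R ∪ armsFalseC A (armPart ω))
    (fun _ hx' _ hxy => hb.blue_closed ω hx' hxy) (Or.inl hr) hx

/-- A vertex of the red cluster of an outside vertex at a cube point is outside `H` or lies in a
`false` arm (never a root). -/
theorem DecoBaseE.mem_notMem_or_false_of_mem_cluster_out (ω : Config (ι ⊕ ↥RR)) {y x : V}
    (hy : y ∉ H) (hx : x ∈ cluster ends (decoRealRR ends A Z RR ζ ω) y) :
    x ∉ H ∨ ∃ i, armPart ω i = false ∧ x ∈ A i :=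
  mem_of_conn_of_closed (S := Hᶜ ∪ armsFalseC A (armPart ω))
    (fun _ hx' _ hxy => hb.red_closed_out ω hx' hxy) (Or.inl hy) hx

/-- A vertex of the blue cluster of an outside vertex at a cube point is outside `H` or lies in a
`true` arm (never a root). -/
theorem DecoBaseE.mem_notMem_or_true_of_mem_cluster_blue_out (ω : Config (ι ⊕ ↥RR)) {y x : V}
    (hy : y ∉ H) (hx : x ∈ cluster ends (blue (decoRealRR ends A Z RR ζ ω)) y) :
    x ∉ H ∨ ∃ i, armPart ω i = true ∧ x ∈ A i :=
  mem_of_conn_of_closed (S := Hᶜ ∪ armsTrueC A (armPart ω))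
    (fun _ hx' _ hxy => hb.blue_closed_out ω hx' hxy) (Or.inl hy) hx

/-- A root is in neither cluster of an outside vertex at a cube point. -/
theorem DecoBaseE.root_notMem_cluster_out (ω : Config (ι ⊕ ↥RR)) {y r : V} (hy : y ∉ H)
    (hr : r ∈ R) :
    r ∉ cluster ends (decoRealRR ends A Z RR ζ ω) y ∧
      r ∉ cluster ends (blue (decoRealRR ends A Z RR ζ ω)) y := by
  constructor
  · intro hr'
    rcases hb.mem_notMem_or_false_of_mem_cluster_out ω hy hr' with h' | ⟨i, _, hi⟩
    · exact h' (hb.base.root_sub hr)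
    · exact hb.base.root_notMem_arm hr i hi
  · intro hr'
    rcases hb.mem_notMem_or_true_of_mem_cluster_blue_out ω hy hr' with h' | ⟨i, _, hi⟩
    · exact h' (hb.base.root_sub hr)
    · exact hb.base.root_notMem_arm hr i hi

/-- The hull of a root at a cube point lies inside `H`. -/
theorem DecoBaseE.hull_subset (ω : Config (ι ⊕ ↥RR)) {r : V} (hr : r ∈ R) :
    hull ends (decoRealRR ends A Z RR ζ ω) r ⊆ H := by
  rintro x (hx | hx)
  · rcases hb.mem_root_or_true_of_mem_cluster ω hr hx with h' | ⟨i, _, hi⟩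
    · exact hb.base.root_sub h'
    · exact (hb.base.arm_sub i x hi).1
  · rcases hb.mem_root_or_false_of_mem_cluster_blue ω hr hx with h' | ⟨i, _, hi⟩
    · exact hb.base.root_sub h'
    · exact (hb.base.arm_sub i x hi).1

end Avoid

end LocRows

end Summit.Ventures.PercRepro2
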